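import Literature.Computability.QuantumComplexity.GluedTrees
import HarnessLib

/-!
# Glued trees, Theorem 9 (classical lower bound) — definitions for the proof

Support file for the proof of `ChildsEtAl2003_thm9` (Childs–Cleve–Deotto–Farhi–Gutmann–Spielman,
*Exponential algorithmic speedup by a quantum walk*, STOC 2003, §4, Theorem 9: "Any classical
algorithm that makes at most `2^{n/6}` queries to the oracle finds the EXIT with probability at
most `4 · 2^{-n/6}`"). The printed proof is a chain of games (Game 1 = the real interaction, …,
Game 5 = a random embedding `π` of the rooted binary tree `T` "seen" by the algorithm into the
random graph `G'_n`, pp. 11–13) followed by Lemma 8 (a union bound on `π`). This file fixes the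
objects of that chain in Lean; it proves nothing beyond unfolding lemmas. All later files of the
proof (`GluedTreesThm9*.lean`) are theorem-only.

## Contents

* §1 Coordinates on `Vertex n`: `depth`, `idx`, `mkV`, `parentV`, `childV`, and the two cross
  neighbours `crossR σ i`, `crossL σ i` of a left/right leaf along the alternating cycle
  `σ = (e, f)` (edges `e k — f k`, `f k — e (k+1)`, as in `GluedTrees.IsGlued`).
* §2 `stepOpts σ v u`: "the neighbors of `π(i)` in `G` other than `π(l)`" (p. 12) — the list of
  neighbours of `v` other than the vertex `u` it was entered from, in a FIXED structural order
  (children by position; parent before the other child; the cross neighbour `f k` before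
  `f (k-1)`). The random embedding flips this order with a fair coin.
* §3 Names: `Name n = Fin (2n) → Bool`, the oracle's encoding `encL` of a list of names as one
  bit string and its partial inverse `decL`, the canonical listing `canon S` of a finite set of
  names (increasing binary value — literally the listing used by `gluedTreesOracle`), and
  `vtx ν a`, the vertex named `a`.
* §4 Views. A deterministic transcript algorithm `M : OracleAlg β` with input `x` is, after `i`
  rounds, in the state given by the list `as` of the `i` answers received (its queries are
  recomputed by `M.step`). `VState` is the bookkeeping the proof attaches to such a list when it
  is GOOD (Game 2–4 discipline: every first query of a known name was answered by the name it was
  reached from plus two FRESH names, repeated queries repeat their answer, unknown strings were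
  answered INVALID = `[]`): the abstract rooted binary tree `T` of known names (node `0` = the
  ENTRANCE's name `0^{2n}`; the `j`-th expansion, of node `par[j]`, creates the nodes `2j+1`,
  `2j+2`), their `label`s, and the set `inv` of strings answered INVALID. `stepState` performs one
  round of this bookkeeping (failing on a bad answer), `viewState M x as` replays a whole answer
  list, `Cons M x O as` says that the oracle `O` produces exactly these answers.
* §5 The random embedding (Game 5, p. 12): `pos σ par c` maps the nodes of the tree with
  expansion list `par` into `G'_n(σ)` — the root to the ENTRANCE, the two children of an expanded
  node to the two `stepOpts` of its position, in the order given by the coin `c j`; `Proper`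
  ("`π(u) ≠ π(v)` for `u ≠ v`"); `coinsOf σ ν s`, the coins realised by an actual naming `ν`;
  `ValidPar` (each node expanded at most once, and only after it exists).
* §6 The counting weights of the coupling: `VState.ext s` = the number of ways to name the
  vertices outside the embedded tree avoiding the used labels and the INVALID strings, and
  `VState.weight s = ext s * 2 ^ E`.

Design notes. Nodes are natural numbers (`0` root, `2j+1`/`2j+2` created by expansion `j`), so a
tree shape is just the list `par` of expanded nodes; positions and labels are total functions on
`ℕ` with junk values (`entrance n`, the zero name) outside `{0, …, 2E}`. When a position has fewer
than two onward neighbours (a root entered from a child — the walk "exits"), the missing child is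
sent to the ENTRANCE, which makes the embedding improper, as the printed Game 5 counts exits as
wins. Everything is classical/noncomputable; no instance is registered.

## References

* [ChildsEtAl2003] A. M. Childs, R. Cleve, E. Deotto, E. Farhi, S. Gutmann, D. A. Spielman,
  Exponential algorithmic speedup by a quantum walk, STOC 2003, §2 and §4 (Games 1–5, Lemmas 4–8,
  Theorem 9).
-/

noncomputable section

open Literature.Computability.Complexity

namespace Literature.Computability.QuantumComplexity

namespace GluedTrees

open Finset

variable {n : ℕ}

/-! ### §1 Coordinates -/

/-- The depth of a vertex (`0` = root of its tree, `n` = leaf). [cite: ChildsEtAl2003, §2] -/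
def depth (v : Vertex n) : ℕ := v.2.1

/-- The position of a vertex within its level, in binary-heap indexing. [cite: ChildsEtAl2003, §2] -/
def idx (v : Vertex n) : ℕ := v.2.2

/-- The position is below `2 ^ depth`. [folklore] -/
theorem idx_lt (v : Vertex n) : idx v < 2 ^ depth v := v.2.2.isLt

/-- The depth is at most `n`. [folklore] -/
theorem depth_le (v : Vertex n) : depth v ≤ n := Nat.lt_succ_iff.mp v.2.1.isLt

/-- Two vertices are equal iff their sides, depths and positions agree. [folklore] -/
theorem Vertex.ext_iff' {u v : Vertex n} :
    u = v ↔ u.1 = v.1 ∧ depth u = depth v ∧ idx u = idx v := by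
  obtain ⟨b, j, i⟩ := u
  obtain ⟨b', j', i'⟩ := v
  constructor
  · rintro h
    cases h
    exact ⟨rfl, rfl, rfl⟩
  · rintro ⟨hb, hj, hi⟩
    simp only [depth, idx] at hb hj hi
    subst hb
    obtain rfl : j = j' := Fin.ext hj
    obtain rfl : i = i' := Fin.ext hi
    rfl

/-- The vertex with the given side, depth `j ≤ n` and position `i < 2 ^ j`. [cite: ChildsEtAl2003, §2] -/
def mkV (b : Bool) (j : ℕ) (hj : j ≤ n) (i : ℕ) (hi : i < 2 ^ j) : Vertex n :=
  (b, ⟨⟨j, Nat.lt_succ_of_le hj⟩, ⟨i, hi⟩⟩)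

/-- The side of `mkV`. [folklore] -/
@[simp] theorem mkV_fst (b : Bool) (j : ℕ) (hj : j ≤ n) (i : ℕ) (hi : i < 2 ^ j) :
    (mkV b j hj i hi).1 = b := rfl

/-- The depth of `mkV`. [folklore] -/
@[simp] theorem depth_mkV (b : Bool) (j : ℕ) (hj : j ≤ n) (i : ℕ) (hi : i < 2 ^ j) :
    depth (mkV b j hj i hi) = j := rfl

/-- The position of `mkV`. [folklore] -/
@[simp] theorem idx_mkV (b : Bool) (j : ℕ) (hj : j ≤ n) (i : ℕ) (hi : i < 2 ^ j) :
    idx (mkV b j hj i hi) = i := rfl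

/-- `idx v / 2` is a valid position one level up. [folklore] -/
theorem idx_div_two_lt (v : Vertex n) : idx v / 2 < 2 ^ (depth v - 1) := by
  have h := idx_lt v
  rcases Nat.eq_zero_or_pos (depth v) with h0 | hpos
  · rw [h0] at h
    rw [h0]
    simp only [pow_zero, Nat.lt_one_iff] at h
    simp [h]
  · rw [Nat.div_lt_iff_lt_mul two_pos]
    calc idx v < 2 ^ depth v := h
      _ = 2 ^ (depth v - 1) * 2 := by rw [← Nat.pow_succ]; congr 1; omega

/-- The parent of a vertex (same side, depth one less, position halved); the junk value at a
root is the root itself. [cite: ChildsEtAl2003, §2] -/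
def parentV (v : Vertex n) : Vertex n :=
  mkV v.1 (depth v - 1) ((Nat.sub_le _ _).trans (depth_le v)) (idx v / 2) (idx_div_two_lt v)

/-- The parent is on the same side. [folklore] -/
@[simp] theorem parentV_fst (v : Vertex n) : (parentV v).1 = v.1 := rfl

/-- The parent is one level up. [folklore] -/
@[simp] theorem depth_parentV (v : Vertex n) : depth (parentV v) = depth v - 1 := rfl

/-- The parent's position is the halved position. [folklore] -/
@[simp] theorem idx_parentV (v : Vertex n) : idx (parentV v) = idx v / 2 := rfl

/-- `2 * idx v + b` is a valid position one level down. [folklore] -/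
theorem two_mul_idx_add_lt (v : Vertex n) (b : Bool) : 2 * idx v + b.toNat < 2 ^ (depth v + 1) := by
  have h := idx_lt v
  have hb : b.toNat ≤ 1 := Bool.toNat_le b
  rw [Nat.pow_succ]
  omega

/-- The `b`-th child of a vertex (same side, depth one more, position `2 i + b`); the junk value
at a leaf is the leaf itself. [cite: ChildsEtAl2003, §2] -/
def childV (v : Vertex n) (b : Bool) : Vertex n :=
  if h : depth v < n then mkV v.1 (depth v + 1) h (2 * idx v + b.toNat) (two_mul_idx_add_lt v b) else v

/-- A child is on the same side. [folklore] -/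
theorem childV_fst (v : Vertex n) (b : Bool) : (childV v b).1 = v.1 := by
  unfold childV; split_ifs <;> rfl

/-- A child is one level down. [folklore] -/
theorem depth_childV {v : Vertex n} (h : depth v < n) (b : Bool) : depth (childV v b) = depth v + 1 := by
  simp [childV, h]

/-- The position of a child. [folklore] -/
theorem idx_childV {v : Vertex n} (h : depth v < n) (b : Bool) : idx (childV v b) = 2 * idx v + b.toNat := by
  simp [childV, h]

/-- The two right neighbours of the left leaf `i` along the cycle `σ = (e, f)`: with `k = e⁻¹ i`,
they are `f k` (edge `e k — f k`) and `f (k - 1)` (edge `f (k-1) — e k`). [cite: ChildsEtAl2003, §2] -/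
def crossR (σ : CycleDatum n) (i : Fin (2 ^ n)) : Fin (2 ^ n) × Fin (2 ^ n) :=
  (σ.2 (σ.1.symm i), σ.2 ((finRotate (2 ^ n)).symm (σ.1.symm i)))

/-- The two left neighbours of the right leaf `i` along the cycle `σ = (e, f)`: with `k = f⁻¹ i`,
they are `e k` (edge `e k — f k`) and `e (k + 1)` (edge `f k — e (k+1)`). [cite: ChildsEtAl2003, §2] -/
def crossL (σ : CycleDatum n) (i : Fin (2 ^ n)) : Fin (2 ^ n) × Fin (2 ^ n) :=
  (σ.1 (σ.2.symm i), σ.1 (finRotate (2 ^ n) (σ.2.symm i)))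

/-- The position of a leaf as an element of `Fin (2 ^ n)`. [folklore] -/
def leafIdx (v : Vertex n) (h : depth v = n) : Fin (2 ^ n) :=
  ⟨idx v, (idx_lt v).trans_eq (by rw [h])⟩

/-- The first cross neighbour of a leaf (`f (e⁻¹ i)` of a left leaf `i`, `e (f⁻¹ i)` of a right
leaf `i`); junk (the vertex itself) at a non-leaf. [cite: ChildsEtAl2003, §2] -/
def cross₁ (σ : CycleDatum n) (v : Vertex n) : Vertex n :=
  if h : depth v = n then
    (if v.1 then leafL n (crossL σ (leafIdx v h)).1 else leafR n (crossR σ (leafIdx v h)).1)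
  else v

/-- The second cross neighbour of a leaf (`f (e⁻¹ i - 1)` of a left leaf `i`, `e (f⁻¹ i + 1)`
of a right leaf `i`); junk (the vertex itself) at a non-leaf. [cite: ChildsEtAl2003, §2] -/
def cross₂ (σ : CycleDatum n) (v : Vertex n) : Vertex n :=
  if h : depth v = n then
    (if v.1 then leafL n (crossL σ (leafIdx v h)).2 else leafR n (crossR σ (leafIdx v h)).2)
  else v

/-- The child of `v` other than `u` (junk `childV v false` if `u` is not a child). [folklore] -/
def otherChild (v u : Vertex n) : Vertex n :=
  if u = childV v false then childV v true else childV v false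

/-! ### §2 The onward neighbours -/

/-- **The onward options of the walk.** For a vertex `v` entered from `u` (`none` only for the
start at the ENTRANCE), the list of neighbours of `v` in `G'_n(σ)` other than `u` ("the
neighbors of `π(i)` in `G` other than `π(l)`", p. 12), in a fixed structural order: the two
children (positions `2i`, `2i+1`) when moving down or starting; `[parent, other child]` when
moving up; `[cross₁, cross₂]` at a leaf entered from its parent; `[parent, other cross neighbour]`
at a leaf entered across the cycle. The one-element list `[other child]` (a root entered from a
child: the walk has reached the EXIT or come back to the ENTRANCE) is the only case with fewer
than two options. [cite: ChildsEtAl2003, §4 (Game 5)] -/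
def stepOpts (σ : CycleDatum n) (v : Vertex n) (u : Option (Vertex n)) : List (Vertex n) :=
  if depth v < n then
    (if u = none ∨ u = some (parentV v) then [childV v false, childV v true]
      else if depth v = 0 then [otherChild v (u.getD v)]
      else [parentV v, otherChild v (u.getD v)])
  else
    (if u = some (parentV v) then [cross₁ σ v, cross₂ σ v]
      else if u = some (cross₁ σ v) then [parentV v, cross₂ σ v]
      else [parentV v, cross₁ σ v])

/-! ### §3 Names, encodings, the canonical listing -/

/-- The names: `2n`-bit strings. [cite: ChildsEtAl2003, §2 and §4 (Game 1)] -/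
abbrev Name (n : ℕ) : Type := Fin (2 * n) → Bool

/-- The oracle's encoding of a list of names as one bit string (concatenation), as in
`GluedTrees.strOracle`. [cite: ChildsEtAl2003, §4 (Game 1)] -/
def encL (L : List (Name n)) : List Bool := (L.map List.ofFn).flatten

open Classical in
/-- The partial inverse of `encL` (`none` on strings that encode no list of names).
[cite: ChildsEtAl2003, §4 (Game 1)] -/
def decL (n : ℕ) (a : List Bool) : Option (List (Name n)) :=
  if h : ∃ L : List (Name n), encL L = a then some h.choose else none

/-- The canonical listing of a finite set of names, by increasing binary value — literally the
listing used by `gluedTreesOracle` (`gluedTreesOracle σ ν a = canon (nbrNames σ ν a)`).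
[cite: ChildsEtAl2003, §4 (Game 1)] -/
def canon (S : Finset (Name n)) : List (Name n) :=
  ((S.image nameVal).sort (· ≤ ·)).map (nameOfVal (2 * n))

/-- The vertex carrying the name `a` under the naming `ν` (junk: the ENTRANCE when `a` names no
vertex). [cite: ChildsEtAl2003, §4 (Game 1)] -/
def vtx (ν : Vertex n ↪ Name n) (a : Name n) : Vertex n :=
  if h : ∃ v, ν v = a then h.choose else entrance n

/-- The name read off a query string of length `2n` (junk: the zero name otherwise).
[cite: ChildsEtAl2003, §4 (Game 1)] -/
def nameOfStr (n : ℕ) (q : List Bool) : Name n :=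
  if h : q.length = 2 * n then fun i ↦ q.get (i.cast h.symm) else fun _ ↦ false

/-! ### §4 Views and their bookkeeping -/

/-- The bookkeeping attached to a good answer list (Games 2–4): `par[j]` is the node expanded at
the `j`-th expansion (which created the nodes `2j+1`, `2j+2`), `label m` is the name of node `m`
(`m ≤ 2 |par|`; junk beyond), `inv` is the set of `2n`-bit strings answered INVALID.
[cite: ChildsEtAl2003, §4 (Games 2–4)] -/
structure VState (n : ℕ) where
  /-- the expanded nodes, in order of expansion -/
  par : List ℕ
  /-- the names of the nodes -/
  label : ℕ → Name n
  /-- the strings answered INVALID -/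
  inv : Finset (Name n)

namespace VState

/-- The number of expansions. [cite: ChildsEtAl2003, §4 (Game 5)] -/
def E (s : VState n) : ℕ := s.par.length

/-- The initial bookkeeping: only the root (node `0`, the ENTRANCE, named `0^{2n}`) is known.
[cite: ChildsEtAl2003, §4 (Game 1)] -/
def init (n : ℕ) : VState n := ⟨[], fun _ _ ↦ false, ∅⟩

/-- The node carrying a known name, if any (the least such node). [cite: ChildsEtAl2003, §4 (Game 2)] -/
def nodeOf? (s : VState n) (a : Name n) : Option ℕ :=
  (List.range (2 * s.E + 1)).find? (fun m ↦ s.label m = a)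

/-- The node whose expansion created node `m ≥ 1` (its parent in the abstract tree; junk `0`
for the root). [cite: ChildsEtAl2003, §4 (Game 5)] -/
def parentNode (s : VState n) (m : ℕ) : ℕ := s.par.getD ((m - 1) / 2) 0

/-- The set of names in the answer to the expansion `j` of node `m`: the name node `m` was reached
from (none for the root) and the two names created. [cite: ChildsEtAl2003, §4 (Game 3)] -/
def answerSet (s : VState n) (j m : ℕ) : Finset (Name n) :=
  (if m = 0 then ∅ else {s.label (s.parentNode m)}) ∪ {s.label (2 * j + 1), s.label (2 * j + 2)}

/-- The set of FRESH names in an expansion answer `L` at node `m`: all of `L` for the root,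
otherwise `L` minus the name node `m` was reached from. [cite: ChildsEtAl2003, §4 (Game 3)] -/
def freshSet (s : VState n) (m : ℕ) (L : List (Name n)) : Finset (Name n) :=
  if m = 0 then L.toFinset else L.toFinset.erase (s.label (s.parentNode m))

/-- The bookkeeping after the expansion of node `m` with fresh pair `F`: `m` is appended to the
expansion list and the new nodes `2E+1`, `2E+2` are labelled by the two elements of `F` in
increasing value (`d` is an irrelevant default). [cite: ChildsEtAl2003, §4 (Game 3)] -/
def expand (s : VState n) (m : ℕ) (F : Finset (Name n)) (d : Name n) : VState n :=
  ⟨s.par ++ [m],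
    Function.update (Function.update s.label (2 * s.E + 1) ((canon F).getD 0 d)) (2 * s.E + 2)
      ((canon F).getD 1 d),
    s.inv⟩

/-- The bookkeeping after an unknown string `a` was answered INVALID. [cite: ChildsEtAl2003, §4 (Game 2)] -/
def addInv (s : VState n) (a : Name n) : VState n := ⟨s.par, s.label, insert a s.inv⟩

open Classical in
/-- **One round of bookkeeping** on query `q` with answer `a`; `none` when the answer is not of
the good kind. Wrong-length queries must get `[]`; a repeated query of an expanded node must get
its recorded answer; the first query of a known node `m` (an EXPANSION) must get the canonical
listing of the name it was reached from (unless `m` is the root) together with exactly two fresh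
names (not known, not INVALID), which become the labels of the new nodes `2E+1`, `2E+2` in
increasing value; an unknown string must get `[]` and is recorded INVALID.
[cite: ChildsEtAl2003, §4 (Games 2–4)] -/
def stepState (s : VState n) (q a : List Bool) : Option (VState n) :=
  if q.length = 2 * n then
    match s.nodeOf? (nameOfStr n q) with
    | some m =>
      if m ∈ s.par then
        (if a = encL (canon (s.answerSet (s.par.idxOf m) m)) then some s else none)
      else
        match decL n a with
        | none => none
        | some L =>
          if L = canon L.toFinset ∧ (s.freshSet m L).card = 2 ∧
              (m ≠ 0 → s.label (s.parentNode m) ∈ L.toFinset) ∧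
              (∀ b ∈ s.freshSet m L, s.nodeOf? b = none ∧ b ∉ s.inv) then
            some (s.expand m (s.freshSet m L) (nameOfStr n q))
          else none
    | none => if a = [] then some (s.addInv (nameOfStr n q)) else none
  else if a = [] then some s else none

end VState

variable {β : Type}

/-- Replay of an answer list from a given bookkeeping state and transcript prefix (the queries are
recomputed by `M.step`; a halted machine cannot receive further answers).
[cite: ChildsEtAl2003, §4 (Games 2–4)] -/
def replayFrom (M : OracleAlg β) (x : List Bool) :
    VState n → List (List Bool) → List (List Bool) → Option (VState n)
  | s, _, [] => some s
  | s, pre, a :: rest =>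
    match M.step x pre with
    | Sum.inr _ => none
    | Sum.inl q =>
      match s.stepState q a with
      | none => none
      | some s' => replayFrom M x s' (pre ++ [a]) rest

/-- **The bookkeeping of a view**: `some s` iff the answer list `as` is GOOD for `(M, x)`, with
`s` its tree of known names, labels and INVALID set. [cite: ChildsEtAl2003, §4 (Games 2–4)] -/
def viewState (M : OracleAlg β) (x : List Bool) (as : List (List Bool)) : Option (VState n) :=
  replayFrom M x (VState.init n) [] as

/-- The oracle `O` is consistent with the answer list `as`: replaying `M` on `x`, every recorded
answer is `O`'s answer to the query asked at that point. [cite: ChildsEtAl2003, §4 (Game 1)] -/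
def Cons (M : OracleAlg β) (x : List Bool) (O : Oracle) (as : List (List Bool)) : Prop :=
  ∀ i (h : i < as.length), ∃ q, M.step x (as.take i) = Sum.inl q ∧ O q = as[i]

/-! ### §5 The random embedding -/

/-- One expansion of the embedding: the children `2j+1`, `2j+2` of the node `par[j]` go to the
two onward options of its position (entered from the position of its own parent node), swapped
iff the coin `c j` is `true`; a missing option is replaced by the ENTRANCE.
[cite: ChildsEtAl2003, §4 (Game 5)] -/
def posStep (σ : CycleDatum n) (par : List ℕ) (c : ℕ → Bool) (j : ℕ) (P : ℕ → Vertex n) :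
    ℕ → Vertex n :=
  let p := par.getD j 0
  let u : Option (Vertex n) := if p = 0 then none else some (P (par.getD ((p - 1) / 2) 0))
  let os := stepOpts σ (P p) u
  Function.update (Function.update P (2 * j + 1) (os.getD (if c j then 1 else 0) (entrance n)))
    (2 * j + 2) (os.getD (if c j then 0 else 1) (entrance n))

/-- The positions after the first `j` expansions of `par` (the root at the ENTRANCE; junk, the
ENTRANCE, at nodes not yet created). [cite: ChildsEtAl2003, §4 (Game 5)] -/
def posAux (σ : CycleDatum n) (par : List ℕ) (c : ℕ → Bool) : ℕ → (ℕ → Vertex n)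
  | 0 => fun _ ↦ entrance n
  | j + 1 => posStep σ par c j (posAux σ par c j)

/-- **The random embedding `π`** of the tree with expansion list `par` and coins `c` into
`G'_n(σ)` (Game 5, p. 12): node `m ↦ pos σ par c m`. [cite: ChildsEtAl2003, §4 (Game 5)] -/
def pos (σ : CycleDatum n) (par : List ℕ) (c : ℕ → Bool) : ℕ → Vertex n :=
  posAux σ par c par.length

/-- The embedding is PROPER: distinct nodes `≤ 2 |par|` have distinct positions ("`π(u) ≠ π(v)`
for `u ≠ v`", p. 12). [cite: ChildsEtAl2003, §4 (Game 5)] -/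
def Proper (σ : CycleDatum n) (par : List ℕ) (c : ℕ → Bool) : Prop :=
  Set.InjOn (pos σ par c) {m | m ≤ 2 * par.length}

/-- A valid expansion list: every node is expanded at most once, and the node expanded at step
`j` exists at that time (`par[j] ≤ 2 j`). [cite: ChildsEtAl2003, §4 (Game 5)] -/
def ValidPar (par : List ℕ) : Prop :=
  par.Nodup ∧ ∀ j (h : j < par.length), par[j] ≤ 2 * j

/-- The coins realised by an actual naming: at expansion `j` of the bookkeeping `s`, whether the
first created node (smaller fresh name) sits at the SECOND onward option of the position of the
expanded node. [cite: ChildsEtAl2003, §4 (Lemma 7)] -/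
def coinsOf (σ : CycleDatum n) (ν : Vertex n ↪ Name n) (s : VState n) (j : ℕ) : Bool :=
  let p := s.par.getD j 0
  let u : Option (Vertex n) := if p = 0 then none else some (vtx ν (s.label (s.parentNode p)))
  decide (vtx ν (s.label (2 * j + 1)) = (stepOpts σ (vtx ν (s.label p)) u).getD 1 (entrance n))

/-! ### §6 Counting weights -/

namespace VState

/-- The number of ways to extend a naming from the `2E+1` embedded nodes to all of `G'_n` while
avoiding the `2E+1` labels and the INVALID strings: injections of the remaining
`|V| - (2E+1)` vertices into the remaining `4^n - (2E+1) - |inv|` names (`0` if the tree has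
more nodes than `G'_n` has vertices). [cite: ChildsEtAl2003, §4 (Lemmas 4 and 7)] -/
def ext (s : VState n) : ℕ :=
  if 2 * s.E + 1 ≤ Fintype.card (Vertex n) then
    (4 ^ n - (2 * s.E + 1 + s.inv.card)).descFactorial (Fintype.card (Vertex n) - (2 * s.E + 1))
  else 0

/-- The weight of a good view in the coupling of Game 1 with Game 5: `ext s * 2 ^ E`.
[cite: ChildsEtAl2003, §4 (Lemma 7)] -/
def weight (s : VState n) : ℕ := s.ext * 2 ^ s.E

end VState

end GluedTrees

end Literature.Computability.QuantumComplexity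

end
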